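import Summits.Ventures.QEC.Census.BB.Claims
import Literature.InformationTheory.QuantumCodes.BivariateBicycleCode360
import Literature.InformationTheory.QuantumCodes.BivariateBicycleCode756
import HarnessLib
import HarnessLib.Audit.Tags

/-!
# The published bivariate-bicycle codes with an UPPER-BOUND-ONLY distance: the CLAIM `[[360, 12, ≤ 24]]`
# (venture QEC, census family BB; companion of `Census/BB/Claims.lean`)

HONEST FRAMING (qec cell, page 1 of every file). Two columns never merge: CERTIFIED = a kernel-checked certificate,
VALIDATED = Monte Carlo. The published parameters of specific codes are CLAIMS until OUR certificate discharges them.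
NOTHING IN THIS FILE ASSERTS THAT A CLAIM HOLDS: the claim is an `@[conjecture] def … : Prop`, an obligation node to be
proved (`theorem BB360_12_le24_claim_holds`, file `Census/BB/BB360Claim.lean`) or refuted.

Source. S. Bravyi, A. W. Cross, J. M. Gambetta, D. Maslov, P. Rall, T. J. Yoder, Nature **627** (2024) 778–782
[BravyiEtAl2024], Extended Data Table 1 (= arXiv:2308.07915v2 Table 3). Besides the five rows with an exact printed
distance (`Census/BB/Claims.lean`: `BB72_12_6_claim` … `BB288_12_18_claim`, predicate `HasParams` with `d` EXACT), the
table prints two rows whose distance entry is an upper bound only — caption (Nature ED Table 1, `paper:url-cd30d32baa9f`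
p0011 L6–7): "Code distance was computed by the mixed integer programming approach of ref. 68. The notation `≤d` indicates
that only an upper bound on the code distance is known at the time of this writing." — namely `[[360, 12, ≤24]]`
(`ℓ = 30, m = 6`, `A = x⁹+y+y²`, `B = y³+x²⁵+x²⁶`; the tree's DATA `BB.bb360`, `BivariateBicycleCode360.lean`, locators there;
main text, arXiv:2308.07915 chunk p0009 L48–50: "The code `[[360,12,≤24]]` improves upon a code `[[882,24,≤24]]` with weight-6
checks found by Panteleev and Kalachev (assuming that our distance upper bound is tight)") and `[[756, 16, ≤34]]` (not yet
typed: no lit-materialised page for its `A, B`). Such a row claims EXACTLY: `n` qubits, `k` logical qubits, and distance AT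
MOST `d` — the shape `HasParamsUB` below; unlike an exact row it is dischargeable by a `k`-certificate plus ONE explicit
logical operator of weight `≤ d` (no lower bound is claimed, none is certified).

* `HasParamsUB C n k d` — "`QC(A, B)` has `n` qubits, `k` logical qubits and distance `≤ d`": `BB.numQubits ℓ m = n`,
  `C.k = k`, `C.d ≤ d` (`C.d = min (d^X, d^Z) = d^X = d^Z`, Lemma 1). Column word: definition.
* `BB360_12_le24_claim` — CLAIM as printed (upper-bound row); certificate: pending (qec census row `BB360`; qec-search-8
  F-A0.1 holds explicit weight-24 logical operators of both types, 2026-08-27).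
* `hasParamsUB_of_dZ_le` / `hasParamsUB_of_dX_le` — discharge interface; `hasParamsUB_of_hasParams` — an exact row
  implies the upper-bound row; `numQubits_bb360'` — the `n`-component holds by counting (certifies nothing else).
-/

namespace Summit.Ventures.QEC.BB

open Literature.InformationTheory.QuantumCodes

/-- "The code `QC(A, B)` has `n` data qubits, `k` logical qubits and distance AT MOST `d`": `BB.numQubits ℓ m = n`,
`BB.Code.k C = k` (the CSS dimension) and `BB.Code.d C ≤ d` (`d = min (d^X, d^Z)`, the least weight of a logical
operator). The census row predicate for a printed `[[n, k, ≤d]]` row of family BB (definition; the caption's "The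
notation `≤d` indicates that only an upper bound on the code distance is known").
[cite: BravyiEtAl2024, Extended Data Table 1 caption (Nature p0011 L6–7) and Lemma 1 (arXiv:2308.07915 chunk p0009 L68)] -/
def HasParamsUB {ℓ m : ℕ} [NeZero ℓ] [NeZero m] (C : BB.Code ℓ m) (n k d : ℕ) : Prop :=
  BB.numQubits ℓ m = n ∧ C.k = k ∧ C.d ≤ d

/-- **CLAIM as printed (upper-bound row)** — the bivariate-bicycle code `QC(x⁹+y+y², y³+x²⁵+x²⁶)` on `ℤ₃₀ × ℤ₆`
(`BB.bb360`) has parameters `[[360, 12, ≤24]]`: 360 data qubits, 12 logical qubits, distance at most 24 (Nature 627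
Extended Data Table 1 = arXiv:2308.07915v2 Table 3, row `[[360,12,≤24]]`, net rate `1/60`; caption p0011 L6–7 "The
notation `≤d` indicates that only an upper bound on the code distance is known at the time of this writing"; main text
arXiv chunk p0009 L48–50 "The code `[[360,12,≤24]]` … (assuming that our distance upper bound is tight)"; `A, B` read on
the secondary page arXiv:2511.13560 Table 1 p0035 L15, see `BB.bb360`). Certificate: pending (qec census row `BB360`).
[cite: BravyiEtAl2024, Extended Data Table 1 row [[360,12,≤24]]; §4 (arXiv:2308.07915 chunk p0009 L48–50)] -/
@[conjecture] def BB360_12_le24_claim : Prop := HasParamsUB BB.bb360 360 12 24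

section Discharge

variable {ℓ m : ℕ} [NeZero ℓ] [NeZero m] {C : BB.Code ℓ m} {n k d : ℕ}

/-- Discharge interface (`Z` side): the qubit count, the dimension and ONE `Z`-side upper bound `d^Z ≤ d` prove
`[[n, k, ≤d]]` — because `d = d^Z` for every `QC(A, B)` (Lemma 1, `BB.Code.d_eq_dZ`). (proved) -/
theorem hasParamsUB_of_dZ_le (hn : BB.numQubits ℓ m = n) (hk : C.k = k) (hd : C.css.dZ ≤ d) :
    HasParamsUB C n k d :=
  ⟨hn, hk, C.d_eq_dZ.trans_le hd⟩

/-- Discharge interface (`X` side): `d^X ≤ d` suffices likewise (`BB.Code.d_eq_dX`). (proved) -/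
theorem hasParamsUB_of_dX_le (hn : BB.numQubits ℓ m = n) (hk : C.k = k) (hd : C.css.dX ≤ d) :
    HasParamsUB C n k d :=
  ⟨hn, hk, C.d_eq_dX.trans_le hd⟩

/-- An exact row `[[n, k, d]]` implies the upper-bound row `[[n, k, ≤d']]` for every `d' ≥ d`. (proved) -/
theorem hasParamsUB_of_hasParams {d' : ℕ} (h : HasParams C n k d) (hd : d ≤ d') : HasParamsUB C n k d' :=
  ⟨h.1, h.2.1, h.2.2.trans_le hd⟩

/-- Conversely an upper-bound row yields both one-sided upper bounds `d^X ≤ d`, `d^Z ≤ d`. (proved) -/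
theorem dX_le_of_hasParamsUB (h : HasParamsUB C n k d) : C.css.dX ≤ d ∧ C.css.dZ ≤ d :=
  ⟨C.d_eq_dX.symm.trans_le h.2.2, C.d_eq_dZ.symm.trans_le h.2.2⟩

end Discharge

/-- The `n`-component of the `[[360,12,≤24]]` claim holds by counting (`n = 2ℓm = 360`); this certifies nothing about
`k` or `d`. (proved) -/
theorem numQubits_bb360' : BB.numQubits 30 6 = 360 :=
  BB.numQubits_bb360

/-! ## APPEND (qec-type-05 gen 4, 2026-08-27): the seventh row `[[756, 16, ≤34]]`

`BB.bb756` (`BivariateBicycleCode756.lean`) is typed now, on the page grade recorded there (arXiv-HTML extraction of Table 3,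
provisional-primary + the secondary page arXiv:2511.13560 p. 34 L39–40 + `k = 16` recomputed; the primary table body is qec
WANTED W1 / acq-11573, open). The CLAIM below is the printed row as an obligation node; by the qec lead's ruling
(2026-08-27T05:38Z) no "as printed" FINDINGS sentence is drawn from its discharge until that primary page is read. -/

/-- **CLAIM as printed (upper-bound row)** — the bivariate-bicycle code `QC(x³+y¹⁰+y¹⁷, y⁵+x³+x¹⁹)` on `ℤ₂₁ × ℤ₁₈`
(`BB.bb756`) has parameters `[[756, 16, ≤34]]`: 756 data qubits, 16 logical qubits, distance at most 34 (Nature 627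
Extended Data Table 1 = arXiv:2308.07915v2 Table 3, row `[[756,16,≤34]]`, net rate `1/95`; caption p0011 L6–7 "The
notation `≤d` indicates that only an upper bound on the code distance is known at the time of this writing"; `(ℓ, m, A, B)`
on the page grade stated in `BivariateBicycleCode756.lean` — primary table body = qec WANTED W1 / acq-11573, open).
Certificate: pending (qec census: `k = 16` KERNEL `Census/BB/BB756RankZ.lean`; the cell's best explicit logical so far has
weight 40, `Census/BB/BB756Bound.lean`; a weight-≤34 logical is being sought).
[cite: BravyiEtAl2024, Extended Data Table 1 row [[756,16,≤34]]] -/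
@[conjecture] def BB756_16_le34_claim : Prop := HasParamsUB BB.bb756 756 16 34

/-- The `n`-component of the `[[756,16,≤34]]` claim holds by counting (`n = 2ℓm = 756`); this certifies nothing about
`k` or `d`. (proved) -/
theorem numQubits_bb756' : BB.numQubits 21 18 = 756 :=
  BB.numQubits_bb756

end Summit.Ventures.QEC.BB
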